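import Mathlib.Analysis.SpecialFunctions.SmoothTransition
import Literature.Topology.FourManifolds.SphereFamilySurgery
import Literature.Topology.FourManifolds.RegularSublevelMaps
import Literature.Topology.FourManifolds.RegularDomainMaps
import Literature.Topology.FourManifolds.GluingUniqueness
import Literature.Topology.FourManifolds.CorkDecomposition
import Literature.Topology.FourManifolds.OrientedConnectedSumSphereSelf
import HarnessLib

/-!
# Surgery inside a regular domain: the decomposition `X = W ∪_Σ M` of a surgered manifold

Topic `Literature/Topology/FourManifolds` (fact seat
`provefact-Literature.Topology.FourManifolds.Matveyev1996_decomposition`; vocabulary of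
`SphereFamilySurgery.lean`, `RegularLevelSplitting.lean`, `Gluing.lean`).  Everything in this
file is **proved**; no statement is introduced.

Matveyev, *A decomposition of smooth simply-connected h-cobordant 4-manifolds*
(J. Differential Geom. 44 (1996); arXiv:dg-ga/9505001), Proof of Theorem, end of the proof of
the first part (arXiv p. 2):

> *"3. Surgery of the manifold obtained in step 2 along collections `{Sᵢ}` and `{Pᵢ}` […]
> Surgery of `V₃` along collections of embedded spheres `{Sᵢ}` and `{Pᵢ}` gives two
> contractible sub-manifolds `W₁` and `W₂` of `M₁` and `M₂`, respectively. Put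
> `M := cl(N ∖ V₃) ≅ cl(M₁ ∖ W₁) ≅ cl(M₂ ∖ W₂)`. So we have the decompositions
> `M₁ = M #_Σ W₁`, `M₂ = M #_Σ W₂`."*

(Kirby, *Akbulut's corks and h-cobordisms of smooth, simply connected 4-manifolds*, Turkish
J. Math. 20 (1996), arXiv:math/9712231, Theorem (2): *"`M - int A` is a product
h-cobordism"*, and §3, last paragraph, read on one end of the h-cobordism; §1: *"The new
boundary on the bottom will be `A₀` because `S₀ × B²` has been removed from
`A_{1/2} × (1/2 - ε)` and replaced by `B³ × S¹`"*.)  Here `M₁`, `M₂` are obtained from the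
middle level `N` by surgery along the framed families `{Pᵢ}`, `{Sᵢ}` (Milnor 1965,
Def. 3.11; `Literature.Topology.FourManifolds.FramedSphereFamily.IsSurgery`), and `V₃ ⊂ N` is
a compact codimension-`0` submanifold with boundary `Σ` containing the tubes of both
families.  This file proves the differential topology of that sentence — everything except
the word "contractible" (the four-dimensional content of steps 1–2 and of Fact 1) — for a
sub-domain presented as a regular sublevel set `V = {g ≤ 0}` of a smooth `g : N → ℝ` with
regular level `0` (`RegularLevelSplitting.lean`), in any dimension:

* `Literature.Topology.FourManifolds.FramedSphereFamily.exists_isRegularLevel_glue` — **the level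
  function descends to the surgered manifold.** If `X = jA(N ∖ cores) ∪ jB(ι × D̊ᵏ⁺¹ × Sˡ)`
  is obtained from `N` by surgery along `ν` (`IsOpenGluingWith … (sphereFamilySurgeryRel ν) jA jB`)
  and the closed unit tubes of `ν` lie in `{g < 0}`, there are `δ > 0` and a smooth
  `ĝ : X → ℝ` with regular level `0`, `ĝ ∘ jA = levelCutoff δ ∘ g` (`= g` where `g ≥ -δ`,
  same sign and zeros as `g` everywhere) and `ĝ ∘ jB ≡ -δ`;
* `Literature.Topology.FourManifolds.FramedSphereFamily.exists_diffeomorph_isBoundaryGluing_regularSuperlevel`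
  — **the exterior is untouched and `X` splits along the level**: `jA` induces a
  diffeomorphism `Φ : {g ≥ 0} ≅ {ĝ ≥ 0}` of regular superlevel sets (manifolds with
  boundary), and `X = W ∪_ψ M` is a gluing along the boundary
  (`Literature.Topology.FourManifolds.IsBoundaryGluing`) of `W := {ĝ ≤ 0}` — compact with all
  the instances of `RegularLevelSplitting.lean` when `X` is compact — and the exterior
  `M := {g ≥ 0} ⊆ N`, **which depends only on `(N, g)`**; so all manifolds obtained from
  `N` by surgeries inside `{g < 0}` share the exterior `M` glued along `Σ = g⁻¹(0)`;
* `Literature.Topology.FourManifolds.FramedSphereFamily.exists_common_exterior_of_isSurgery` —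
  the printed sentence for two surgeries `X₁`, `X₂` of `N` inside `{g < 0}`, with the pieces
  pinned: `X₁ = W₁ ∪_{φ₁} M`, `X₂ = W₂ ∪_{φ₂} M` for the **fixed** exterior `M = {g ≥ 0}`
  (`RegularSuperlevel h0`) and `Wᵢ = {ĝᵢ ≤ 0}` for returned level functions `ĝᵢ`
  (`= levelCutoff δᵢ ∘ g` on `N ∖ cores`, `≡ -δᵢ` on the new pieces, through returned gluing
  embeddings), seams `φᵢ` characterised pointwise — the conclusion of
  `Literature.Topology.FourManifolds.Matveyev1996_partOne_and_fact_of_dualSpheres` (H4,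
  `CorkDecompositionMiddleLevel.lean`) with the pieces made explicit, minus contractibility
  and Fact 1.

The tools, of independent use (all proved):

* `Literature.Topology.FourManifolds.levelCutoff` — a smooth `ℝ → ℝ` equal to `t` for
  `t ≥ -δ`, constant `-δ` for `t ≤ -2δ`, sign- and zero-preserving
  (Mathlib's `Real.smoothTransition`);
* `Literature.Topology.FourManifolds.RegularSublevel.mapOfMapsTo`, `contMDiff_mapOfMapsTo` — a
  smooth map of ambient manifolds with `e({f ≤ a}) ⊆ {f' ≤ a'}` induces a smooth map of the
  regular sublevel sets (Lee 2013, Cor. 5.30 via `HalfSliceAtlas.contMDiff_codRestrict`;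
  compare `RegularSublevel.map` of `RegularSublevelMaps.lean`, the equivariant case);
* `Literature.Topology.FourManifolds.RegularSublevel.equivOfIsOpenRange` — **regular sublevel
  sets correspond under open smooth embeddings** `e` with `f' (e x) ≤ a' ↔ f x ≤ a` and
  `{f' ≤ a'} ⊆ e(M)`: a diffeomorphism `{f ≤ a} ≅ {f' ≤ a'}` (inverse smooth by descent
  along the open immersion, `contMDiffAt_of_comp_isImmersionAt` of `GluingUniqueness.lean`;
  Kosinski 1993, VI.1);
* `Literature.Topology.FourManifolds.IsMCriticalPt.comp`,
  `Literature.Topology.FourManifolds.isMCriticalPt_comp_subtype_val_iff`,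
  `Literature.Topology.FourManifolds.IsRegularLevel.comp_isSmoothEmbedding` — critical points
  under smooth maps, on open submanifolds, and **regular levels pull back along open smooth
  embeddings**;
* `Literature.Topology.FourManifolds.IsOpenGluingWith.exists_contMDiff_apply_eq` — smooth
  functions on an open gluing are pairs of compatible smooth functions on the pieces
  (Kosinski 1993, VI.1).

What is *not* here (and is the genuinely four-dimensional part of (H4)): the construction of
`V₃` (Casson moves, Matveyev's Lemma 1, 1-handles and essential 2-handles; Kirby §3), the
contractibility of `W₁`, `W₂`, and Fact 1 (`W₁ #_Σ W₁ ≅ S⁴ ≅ W₁ #_Σ W₂`, Kirby calculus /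
Addenda (B), (C)).

## References

* R. Matveyev, *A decomposition of smooth simply-connected h-cobordant 4-manifolds*,
  J. Differential Geom. 44 (1996) 571–582; arXiv:dg-ga/9505001, Proof of Theorem, step 3 and
  the definition of `M` (arXiv p. 2). [Matveyev1996]
* R. Kirby, *Akbulut's corks and h-cobordisms of smooth, simply connected 4-manifolds*, Turkish
  J. Math. 20 (1996) 85–93; arXiv:math/9712231, Theorem (2), §1, §3 (last paragraph).
  [KirbyCorks1996]
* J. Milnor, *Lectures on the h-cobordism theorem*, Princeton (1965), Def. 3.11 (PDF p. 17),
  §3 p. 21. [MilnorHCobordism1965]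
* A. Kosinski, *Differential Manifolds* (1993), Ch. VI §1. [Kosinski1993]
* J. M. Lee, *Introduction to Smooth Manifolds*, 2nd ed. (2013), Cor. 5.30, Prop. 5.47.
  [LeeSmoothManifolds2013]
-/

open scoped Manifold ContDiff Topology
open Set Function Filter

noncomputable section

universe u v w

namespace Literature.Topology.FourManifolds

/-- Local notation: `𝔼 n` is the model Euclidean space `EuclideanSpace ℝ (Fin n)`. -/
local notation "𝔼 " n:arg => EuclideanSpace ℝ (Fin n)

/-- Local notation: `𝕊 n` is the unit sphere in `EuclideanSpace ℝ (Fin (n + 1))`. -/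
local notation "𝕊 " n:arg => (Metric.sphere (0 : EuclideanSpace ℝ (Fin (n + 1))) 1)

/-! ### §1 A cutoff flattening a function below a negative level -/

section Cutoff

/-- **Level cutoff.** `levelCutoff δ t = -δ + χ((t + 2δ)/δ) · (t + δ)` with `χ` Mathlib's
`Real.smoothTransition`: a smooth function of `t` equal to `t` for `t ≥ -δ`, to the constant
`-δ` for `t ≤ -2δ`, and negative for `t < -δ` (`δ > 0`). Post-composing a function `g` with it
leaves `g` unchanged where `g ≥ -δ` (in particular near the level `g = 0`) and makes it
constant where `g ≤ -2δ`. [folklore] -/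
def levelCutoff (δ t : ℝ) : ℝ :=
  -δ + Real.smoothTransition ((t + 2 * δ) / δ) * (t + δ)

variable {δ : ℝ}

/-- Above `-δ` the cutoff is the identity. [folklore] -/
theorem levelCutoff_of_neg_le (hδ : 0 < δ) {t : ℝ} (ht : -δ ≤ t) : levelCutoff δ t = t := by
  have h1 : (1 : ℝ) ≤ (t + 2 * δ) / δ := by
    rw [le_div_iff₀ hδ]
    linarith
  rw [levelCutoff, Real.smoothTransition.one_of_one_le h1]
  ring

/-- Below `-2δ` the cutoff is the constant `-δ`. [folklore] -/
theorem levelCutoff_of_le (hδ : 0 < δ) {t : ℝ} (ht : t ≤ -(2 * δ)) : levelCutoff δ t = -δ := by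
  have h1 : (t + 2 * δ) / δ ≤ 0 := div_nonpos_of_nonpos_of_nonneg (by linarith) hδ.le
  rw [levelCutoff, Real.smoothTransition.zero_of_nonpos h1]
  ring

/-- Below `-δ` the cutoff is negative (indeed `≤ -δ`). [folklore] -/
theorem levelCutoff_neg_of_lt (hδ : 0 < δ) {t : ℝ} (ht : t < -δ) : levelCutoff δ t < 0 := by
  have h1 : Real.smoothTransition ((t + 2 * δ) / δ) * (t + δ) ≤ 0 :=
    mul_nonpos_of_nonneg_of_nonpos (Real.smoothTransition.nonneg _) (by linarith)
  rw [levelCutoff]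
  linarith

/-- The cutoff does not change the sign: `levelCutoff δ t ≤ 0 ↔ t ≤ 0`. [folklore] -/
theorem levelCutoff_nonpos_iff (hδ : 0 < δ) (t : ℝ) : levelCutoff δ t ≤ 0 ↔ t ≤ 0 := by
  rcases le_or_gt (-δ) t with ht | ht
  · rw [levelCutoff_of_neg_le hδ ht]
  · exact ⟨fun _ => by linarith, fun _ => (levelCutoff_neg_of_lt hδ ht).le⟩

/-- The cutoff does not change the sign: `0 ≤ levelCutoff δ t ↔ 0 ≤ t`. [folklore] -/
theorem levelCutoff_nonneg_iff (hδ : 0 < δ) (t : ℝ) : 0 ≤ levelCutoff δ t ↔ 0 ≤ t := by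
  rcases le_or_gt (-δ) t with ht | ht
  · rw [levelCutoff_of_neg_le hδ ht]
  · exact ⟨fun h => absurd (levelCutoff_neg_of_lt hδ ht) (not_lt.2 h), fun h => by linarith⟩

/-- The cutoff does not change the zero set: `levelCutoff δ t = 0 ↔ t = 0`. [folklore] -/
theorem levelCutoff_eq_zero_iff (hδ : 0 < δ) (t : ℝ) : levelCutoff δ t = 0 ↔ t = 0 := by
  rcases le_or_gt (-δ) t with ht | ht
  · rw [levelCutoff_of_neg_le hδ ht]
  · exact ⟨fun h => absurd (levelCutoff_neg_of_lt hδ ht) (by rw [h]; exact lt_irrefl 0),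
      fun h => by linarith⟩

/-- The cutoff is smooth. [folklore] -/
theorem contDiff_levelCutoff (δ : ℝ) : ContDiff ℝ ∞ (levelCutoff δ) := by
  unfold levelCutoff
  exact contDiff_const.add ((Real.smoothTransition.contDiff.comp
    ((contDiff_id.add contDiff_const).div_const δ)).mul (contDiff_id.add contDiff_const))

/-- Post-composition with the cutoff does not change a function near a point where it is
`> -δ`. [folklore] -/
theorem levelCutoff_comp_eventuallyEq {X : Type*} [TopologicalSpace X] {g : X → ℝ}
    (hg : Continuous g) (hδ : 0 < δ) {x : X} (hx : -δ < g x) :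
    (fun y => levelCutoff δ (g y)) =ᶠ[𝓝 x] g := by
  filter_upwards [(isOpen_lt continuous_const hg).mem_nhds hx] with y hy
  exact levelCutoff_of_neg_le hδ (le_of_lt hy)

end Cutoff

/-! ### §2 Regular sublevel sets under smooth maps and open embeddings -/

namespace RegularSublevel

variable {k : ℕ} {M : Type u} [TopologicalSpace M] [ChartedSpace (𝔼 (k + 1)) M]
  [IsManifold (𝓡 (k + 1)) ∞ M] {M' : Type u} [TopologicalSpace M'] [ChartedSpace (𝔼 (k + 1)) M']
  [IsManifold (𝓡 (k + 1)) ∞ M'] {f : M → ℝ} {f' : M' → ℝ} {a a' : ℝ}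
  (h₁ : IsRegularLevel (𝓡 (k + 1)) f a) (h₂ : IsRegularLevel (𝓡 (k + 1)) f' a')

/-- The map `{f ≤ a} → {f' ≤ a'}` induced by a map `e : M → M'` of the ambient manifolds with
`e({f ≤ a}) ⊆ {f' ≤ a'}` (no intertwining condition; compare `RegularSublevel.map`, the case
`f' ∘ e = f`, `a' = a`). [folklore] -/
def mapOfMapsTo (e : M → M') (he : ∀ x, f x ≤ a → f' (e x) ≤ a') :
    RegularSublevel h₁ → RegularSublevel h₂ :=
  fun p => mk h₂ (e (incl h₁ p)) (he _ (apply_incl_le h₁ p))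

omit [IsManifold (𝓡 (k + 1)) ∞ M] [IsManifold (𝓡 (k + 1)) ∞ M'] in
/-- `mapOfMapsTo` on points of the ambient manifolds (definitional). [folklore] -/
@[simp]
theorem incl_mapOfMapsTo (e : M → M') (he : ∀ x, f x ≤ a → f' (e x) ≤ a')
    (p : RegularSublevel h₁) : incl h₂ (mapOfMapsTo h₁ h₂ e he p) = e (incl h₁ p) := rfl

/-- **A smooth map of the ambient manifolds mapping `{f ≤ a}` into `{f' ≤ a'}` induces a smooth
map of the regular sublevel sets** (as manifolds with boundary): it is smooth into `M'`
(`incl` is smooth) with values in the regular domain `{f' ≤ a'}`, hence smooth into it (Lee,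
*Introduction to Smooth Manifolds* (2013), Cor. 5.30, in the form
`HalfSliceAtlas.contMDiff_codRestrict`). [cite: LeeSmoothManifolds2013, Cor. 5.30] -/
theorem contMDiff_mapOfMapsTo {e : M → M'} (hes : ContMDiff (𝓡 (k + 1)) (𝓡 (k + 1)) ∞ e)
    (he : ∀ x, f x ≤ a → f' (e x) ≤ a') :
    ContMDiff (𝓡∂ (k + 1)) (𝓡∂ (k + 1)) ∞ (mapOfMapsTo h₁ h₂ e he) :=
  (halfSliceAtlas h₂).contMDiff_codRestrict (g := fun p : RegularSublevel h₁ => e (incl h₁ p))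
    (fun p => he _ (apply_incl_le h₁ p)) (hes.comp (contMDiff_incl h₁))

/-- A map into `M` which is smooth on the regular sublevel set `{f' ≤ a'}` of `M'` — in the
sense that it is the composite of `incl` with a map `s : M' → M` smooth on an open set
containing `{f' ≤ a'}` — and takes values in `{f ≤ a}` is smooth into `{f ≤ a}`.
[cite: LeeSmoothManifolds2013, Cor. 5.30] -/
theorem contMDiff_mk_comp {s : M' → M} {U : Set M'} (hs : ContMDiffOn (𝓡 (k + 1)) (𝓡 (k + 1)) ∞ s U)
    (hU : f' ⁻¹' Iic a' ⊆ U) (hmem : ∀ q : RegularSublevel h₂, f (s (incl h₂ q)) ≤ a) :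
    ContMDiff (𝓡∂ (k + 1)) (𝓡∂ (k + 1)) ∞
      (fun q : RegularSublevel h₂ => mk h₁ (s (incl h₂ q)) (hmem q)) :=
  (halfSliceAtlas h₁).contMDiff_codRestrict (g := fun q : RegularSublevel h₂ => s (incl h₂ q))
    hmem (hs.comp_contMDiff (contMDiff_incl h₂) fun q => hU (apply_incl_le h₂ q))

omit [TopologicalSpace M] [ChartedSpace (𝔼 (k + 1)) M] [IsManifold (𝓡 (k + 1)) ∞ M]
  [IsManifold (𝓡 (k + 1)) ∞ M'] in
/-- The inverse of an open embedding `e` on a sublevel set `{f' ≤ a'} ⊆ e(M)`, on points: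
the unique `x` with `e x = incl q`. [folklore] -/
def preimagePoint {e : M → M'} (hsub : f' ⁻¹' Iic a' ⊆ range e) (q : RegularSublevel h₂) : M :=
  Classical.choose (hsub (apply_incl_le h₂ q))

omit [TopologicalSpace M] [ChartedSpace (𝔼 (k + 1)) M] [IsManifold (𝓡 (k + 1)) ∞ M]
  [IsManifold (𝓡 (k + 1)) ∞ M'] in
/-- Defining property of `preimagePoint`: `e (preimagePoint q) = incl q`. [folklore] -/
theorem apply_preimagePoint {e : M → M'} (hsub : f' ⁻¹' Iic a' ⊆ range e)
    (q : RegularSublevel h₂) : e (preimagePoint h₂ hsub q) = incl h₂ q :=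
  Classical.choose_spec (hsub (apply_incl_le h₂ q))

omit [TopologicalSpace M] [ChartedSpace (𝔼 (k + 1)) M] [IsManifold (𝓡 (k + 1)) ∞ M]
  [IsManifold (𝓡 (k + 1)) ∞ M'] in
/-- `preimagePoint` is `incl` followed by any left inverse of `e`. [folklore] -/
theorem preimagePoint_eq {e : M → M'} (hsub : f' ⁻¹' Iic a' ⊆ range e) {s : M' → M}
    (hs : ∀ x, s (e x) = x) (q : RegularSublevel h₂) :
    preimagePoint h₂ hsub q = s (incl h₂ q) := by
  rw [← apply_preimagePoint h₂ hsub q, hs]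

omit [IsManifold (𝓡 (k + 1)) ∞ M] [IsManifold (𝓡 (k + 1)) ∞ M'] in
/-- For injective `e`, `preimagePoint (e p) = p`. [folklore] -/
theorem preimagePoint_mapOfMapsTo {e : M → M'} (hinj : Injective e)
    (he : ∀ x, f x ≤ a → f' (e x) ≤ a') (hsub : f' ⁻¹' Iic a' ⊆ range e)
    (p : RegularSublevel h₁) : preimagePoint h₂ hsub (mapOfMapsTo h₁ h₂ e he p) = incl h₁ p :=
  hinj (apply_preimagePoint h₂ hsub _)

omit [TopologicalSpace M] [ChartedSpace (𝔼 (k + 1)) M] [IsManifold (𝓡 (k + 1)) ∞ M]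
  [IsManifold (𝓡 (k + 1)) ∞ M'] in
/-- The preimage point lies in `{f ≤ a}` when `f' (e x) ≤ a' ↔ f x ≤ a`. [folklore] -/
theorem apply_preimagePoint_le {e : M → M'} (hiff : ∀ x, f' (e x) ≤ a' ↔ f x ≤ a)
    (hsub : f' ⁻¹' Iic a' ⊆ range e) (q : RegularSublevel h₂) :
    f (preimagePoint h₂ hsub q) ≤ a := by
  rw [← hiff, apply_preimagePoint h₂ hsub q]
  exact apply_incl_le h₂ q

/-- **Regular sublevel sets correspond under open smooth embeddings.** Let `e : M → M'` be a
smooth embedding with open range between manifolds without boundary, `f`, `f'` smooth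
functions with regular levels `a`, `a'` such that `f' (e x) ≤ a' ↔ f x ≤ a` and
`{f' ≤ a'} ⊆ e(M)`. Then `e` induces a diffeomorphism `{f ≤ a} ≅ {f' ≤ a'}` of the regular
sublevel sets, as manifolds with boundary. (The inverse is `incl` followed by the inverse of
`e` on its open range, smooth by descent of smoothness along the open immersion `e`,
`contMDiffAt_of_comp_isImmersionAt`.) Kosinski, *Differential Manifolds* (1993), VI.1 (the
projections of a gluing are diffeomorphisms onto their images); Lee (2013), Cor. 5.30.
[cite: Kosinski1993, Ch. VI §1] -/
def equivOfIsOpenRange (e : M → M')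
    (hemb : Manifold.IsSmoothEmbedding (𝓡 (k + 1)) (𝓡 (k + 1)) ∞ e) (ho : IsOpen (range e))
    (hiff : ∀ x, f' (e x) ≤ a' ↔ f x ≤ a) (hsub : f' ⁻¹' Iic a' ⊆ range e) :
    RegularSublevel h₁ ≃ₘ⟮𝓡∂ (k + 1), 𝓡∂ (k + 1)⟯ RegularSublevel h₂ where
  toFun := mapOfMapsTo h₁ h₂ e fun x hx => (hiff x).2 hx
  invFun q := mk h₁ (preimagePoint h₂ hsub q) (apply_preimagePoint_le h₂ hiff hsub q)
  left_inv p := injective_incl h₁ (by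
    rw [incl_mk]
    exact preimagePoint_mapOfMapsTo h₁ h₂ hemb.isEmbedding.injective
      (fun x hx => (hiff x).2 hx) hsub p)
  right_inv q := injective_incl h₂ (by
    rw [incl_mapOfMapsTo, incl_mk]
    exact apply_preimagePoint h₂ hsub q)
  contMDiff_toFun := contMDiff_mapOfMapsTo h₁ h₂ hemb.contMDiff fun x hx => (hiff x).2 hx
  contMDiff_invFun := by
    rcases isEmpty_or_nonempty M with hM | hM
    · exact fun q => (IsEmpty.false (preimagePoint h₂ hsub q)).elim
    · set s : M' → M := Function.invFun e with hs
      have hse : ∀ x, s (e x) = x := Function.leftInverse_invFun hemb.isEmbedding.injective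
      have hsm : ContMDiffOn (𝓡 (k + 1)) (𝓡 (k + 1)) ∞ s (range e) := by
        rintro _ ⟨x, rfl⟩
        exact (contMDiffAt_of_comp_isImmersionAt (hemb.isImmersion.isImmersionAt x)
          (Topology.IsOpenEmbedding.isOpenMap ⟨hemb.isEmbedding, ho⟩) contMDiffAt_id
          hse).contMDiffWithinAt
      have hmem : ∀ q : RegularSublevel h₂, f (s (incl h₂ q)) ≤ a := fun q => by
        rw [← preimagePoint_eq h₂ hsub hse q]
        exact apply_preimagePoint_le h₂ hiff hsub q
      have heq : (fun q : RegularSublevel h₂ =>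
          mk h₁ (preimagePoint h₂ hsub q) (apply_preimagePoint_le h₂ hiff hsub q)) =
          fun q => mk h₁ (s (incl h₂ q)) (hmem q) := by
        funext q
        exact injective_incl h₁ (by rw [incl_mk, incl_mk, preimagePoint_eq h₂ hsub hse q])
      show ContMDiff (𝓡∂ (k + 1)) (𝓡∂ (k + 1)) ∞ fun q : RegularSublevel h₂ =>
        mk h₁ (preimagePoint h₂ hsub q) (apply_preimagePoint_le h₂ hiff hsub q)
      rw [heq]
      exact contMDiff_mk_comp h₁ h₂ hsm hsub hmem

/-- `equivOfIsOpenRange` on points of the ambient manifolds (definitional). [folklore] -/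
@[simp]
theorem incl_equivOfIsOpenRange (e : M → M')
    (hemb : Manifold.IsSmoothEmbedding (𝓡 (k + 1)) (𝓡 (k + 1)) ∞ e) (ho : IsOpen (range e))
    (hiff : ∀ x, f' (e x) ≤ a' ↔ f x ≤ a) (hsub : f' ⁻¹' Iic a' ⊆ range e)
    (p : RegularSublevel h₁) :
    incl h₂ (equivOfIsOpenRange h₁ h₂ e hemb ho hiff hsub p) = e (incl h₁ p) := rfl

/-- The inverse of `equivOfIsOpenRange` on points of the ambient manifolds:
`e (incl (Φ⁻¹ q)) = incl q`. [folklore] -/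
theorem apply_incl_equivOfIsOpenRange_symm (e : M → M')
    (hemb : Manifold.IsSmoothEmbedding (𝓡 (k + 1)) (𝓡 (k + 1)) ∞ e) (ho : IsOpen (range e))
    (hiff : ∀ x, f' (e x) ≤ a' ↔ f x ≤ a) (hsub : f' ⁻¹' Iic a' ⊆ range e)
    (q : RegularSublevel h₂) :
    e (incl h₁ ((equivOfIsOpenRange h₁ h₂ e hemb ho hiff hsub).symm q)) = incl h₂ q :=
  apply_preimagePoint h₂ hsub q

end RegularSublevel

/-! ### §3 Critical points under smooth maps and open submanifolds -/

section Critical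

variable {EA HA EP HP : Type*}
  [NormedAddCommGroup EA] [NormedSpace ℝ EA] [TopologicalSpace HA] {IA : ModelWithCorners ℝ EA HA}
  [NormedAddCommGroup EP] [NormedSpace ℝ EP] [TopologicalSpace HP] {IP : ModelWithCorners ℝ EP HP}
  {A : Type*} [TopologicalSpace A] [ChartedSpace HA A]
  {P : Type*} [TopologicalSpace P] [ChartedSpace HP P]

/-- **Chain rule for critical points**: if `G` is critical at `j a` then `G ∘ j` is critical at
`a` (both differentiable). Contrapositively, a regular point of `G ∘ j` maps to a regular point
of `G`. [folklore] -/
theorem IsMCriticalPt.comp {j : A → P} {G : P → ℝ} {a : A} (hc : IsMCriticalPt IP G (j a))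
    (hG : MDifferentiableAt IP 𝓘(ℝ, ℝ) G (j a)) (hj : MDifferentiableAt IA IP j a) :
    IsMCriticalPt IA (G ∘ j) a := by
  unfold IsMCriticalPt at hc ⊢
  rw [mfderiv_comp a hG hj, hc, ContinuousLinearMap.zero_comp]
  rfl

/-- **Critical points on an open submanifold** are the critical points of the ambient
function: for `U` open in `M` and `F : M → ℝ` differentiable at `x ∈ U`, `F|_U` is critical at
`x` iff `F` is (the inclusion has identity differential, `mfderiv_subtype_val`). [folklore] -/
theorem isMCriticalPt_comp_subtype_val_iff {U : TopologicalSpace.Opens P} {F : P → ℝ} {x : U}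
    (hF : MDifferentiableAt IP 𝓘(ℝ, ℝ) F x.1) :
    IsMCriticalPt IP (F ∘ Subtype.val : U → ℝ) x ↔ IsMCriticalPt IP F x.1 := by
  have h1 : HasMFDerivAt IP 𝓘(ℝ, ℝ) (F ∘ Subtype.val : U → ℝ) x
      ((mfderiv IP 𝓘(ℝ, ℝ) F x.1).comp (ContinuousLinearMap.id ℝ EP)) :=
    hF.hasMFDerivAt.comp x (hasMFDerivAt_subtype_val x)
  have h2 : mfderiv IP 𝓘(ℝ, ℝ) (F ∘ Subtype.val : U → ℝ) x = mfderiv IP 𝓘(ℝ, ℝ) F x.1 :=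
    h1.mfderiv.trans (ContinuousLinearMap.ext fun v => rfl)
  unfold IsMCriticalPt
  rw [h2]
  exact Iff.rfl

end Critical

/-! ### §4 Smooth functions on an open gluing -/

section GlueFunction

variable {EA HA EB HB EP HP : Type*}
  [NormedAddCommGroup EA] [NormedSpace ℝ EA] [TopologicalSpace HA] {IA : ModelWithCorners ℝ EA HA}
  [NormedAddCommGroup EB] [NormedSpace ℝ EB] [TopologicalSpace HB] {IB : ModelWithCorners ℝ EB HB}
  [NormedAddCommGroup EP] [NormedSpace ℝ EP] [TopologicalSpace HP] {IP : ModelWithCorners ℝ EP HP}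
  {A B P : Type*} [TopologicalSpace A] [ChartedSpace HA A] [TopologicalSpace B]
  [ChartedSpace HB B] [TopologicalSpace P] [ChartedSpace HP P]
  {R : A → B → Prop} {jA : A → P} {jB : B → P}

/-- **Smooth functions on a gluing are pairs of compatible smooth functions on the pieces.**
If `P = jA(A) ∪ jB(B)` is an open gluing along `R` and `FA : A → ℝ`, `FB : B → ℝ` are smooth
functions with `FA a = FB b` whenever `R a b`, there is a smooth `G : P → ℝ` with `G ∘ jA = FA`
and `G ∘ jB = FB` (set-theoretically `IsOpenGluing.exists_map_apply_eq`; smooth by descent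
along the open embeddings, `IsOpenGluing.contMDiff_of_comp_eq`). Kosinski, *Differential
Manifolds* (1993), VI.1 ("the unique structure for which the projections are
diffeomorphisms"). [cite: Kosinski1993, Ch. VI §1] -/
theorem IsOpenGluingWith.exists_contMDiff_apply_eq (h : IsOpenGluingWith IA IB IP R jA jB)
    {FA : A → ℝ} {FB : B → ℝ} (hFA : ContMDiff IA 𝓘(ℝ, ℝ) ∞ FA)
    (hFB : ContMDiff IB 𝓘(ℝ, ℝ) ∞ FB) (hcomp : ∀ a b, R a b → FA a = FB b) :
    ∃ G : P → ℝ, ContMDiff IP 𝓘(ℝ, ℝ) ∞ G ∧ (∀ a, G (jA a) = FA a) ∧ ∀ b, G (jB b) = FB b := by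
  obtain ⟨hA, hAo, hB, hBo, hU, hR⟩ := h
  obtain ⟨G, hGA, hGB⟩ := IsOpenGluing.exists_map_apply_eq (jA' := FA) (jB' := FB) hU
    hA.isEmbedding.injective hB.isEmbedding.injective fun a b hab => hcomp a b ((hR a b).1 hab)
  refine ⟨G, fun p => ?_, hGA, hGB⟩
  rcases eq_univ_iff_forall.1 hU p with ⟨a, rfl⟩ | ⟨b, rfl⟩
  · exact contMDiffAt_of_comp_isImmersionAt (hA.isImmersion.isImmersionAt a)
      (Topology.IsOpenEmbedding.isOpenMap ⟨hA.isEmbedding, hAo⟩) (hFA a) hGA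
  · exact contMDiffAt_of_comp_isImmersionAt (hB.isImmersion.isImmersionAt b)
      (Topology.IsOpenEmbedding.isOpenMap ⟨hB.isEmbedding, hBo⟩) (hFB b) hGB

end GlueFunction

/-! ### §5 Regular levels pull back along open smooth embeddings -/

section PullbackLevel

variable {k : ℕ} {M : Type u} [TopologicalSpace M] [ChartedSpace (𝔼 (k + 1)) M]
  [IsManifold (𝓡 (k + 1)) ∞ M] {M' : Type u} [TopologicalSpace M'] [ChartedSpace (𝔼 (k + 1)) M']

/-- **A regular level pulls back to a regular level along an open smooth embedding.** If `a`
is a regular level of `G : M' → ℝ` and `j : M → M'` is a smooth embedding with open range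
(between manifolds without boundary of the same dimension), then `a` is a regular level of
`G ∘ j`: near `j x` one has `G = (G ∘ j) ∘ s` for the local inverse `s` of `j`, smooth by
descent along the open immersion `j` (`contMDiffAt_of_comp_isImmersionAt`), so a critical
point of `G ∘ j` at `x` would make `j x` a critical point of `G` (chain rule). [folklore] -/
theorem IsRegularLevel.comp_isSmoothEmbedding {G : M' → ℝ} {a : ℝ}
    (hG : IsRegularLevel (𝓡 (k + 1)) G a) {j : M → M'}
    (hj : Manifold.IsSmoothEmbedding (𝓡 (k + 1)) (𝓡 (k + 1)) ∞ j) (ho : IsOpen (range j)) :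
    IsRegularLevel (𝓡 (k + 1)) (G ∘ j) a := by
  refine isRegularLevel_of_not_isMCriticalPt (hG.contMDiff.comp hj.contMDiff) fun x hx hc => ?_
  haveI : Nonempty M := ⟨x⟩
  set s : M' → M := Function.invFun j with hs
  have hsj : ∀ y, s (j y) = y := Function.leftInverse_invFun hj.isEmbedding.injective
  have hsd : ContMDiffAt (𝓡 (k + 1)) (𝓡 (k + 1)) ∞ s (j x) :=
    contMDiffAt_of_comp_isImmersionAt (hj.isImmersion.isImmersionAt x)
      (Topology.IsOpenEmbedding.isOpenMap ⟨hj.isEmbedding, ho⟩) contMDiffAt_id hsj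
  have hc' : IsMCriticalPt (𝓡 (k + 1)) (G ∘ j) (s (j x)) := by rwa [hsj]
  have hGj : MDifferentiableAt (𝓡 (k + 1)) 𝓘(ℝ, ℝ) (G ∘ j) (s (j x)) := by
    rw [hsj]
    exact ((hG.contMDiff.comp hj.contMDiff) x).mdifferentiableAt (by simp)
  have hcomp : IsMCriticalPt (𝓡 (k + 1)) ((G ∘ j) ∘ s) (j x) :=
    hc'.comp hGj (hsd.mdifferentiableAt (by simp))
  have hev : ((G ∘ j) ∘ s) =ᶠ[𝓝 (j x)] G := by
    filter_upwards [ho.mem_nhds (mem_range_self x)] with y hy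
    obtain ⟨z, rfl⟩ := hy
    simp only [comp_apply, hsj]
  apply hG.not_isMCriticalPt (x := j x) hx
  unfold IsMCriticalPt at hcomp ⊢
  rwa [hev.mfderiv_eq] at hcomp

end PullbackLevel

/-! ### §6 Surgery inside a regular domain -/

section Surgery

variable {n k l : ℕ} {N : Type u} [TopologicalSpace N] [T2Space N] [ChartedSpace (𝔼 (n + 1)) N]
  [IsManifold (𝓡 (n + 1)) ∞ N] {ι : Type v} [Finite ι]

namespace FramedSphereFamily

omit [T2Space N] [IsManifold (𝓡 (n + 1)) ∞ N] in
/-- If the closed unit tubes `φᵢ(Sᵏ × D̄)` of a finite framed family lie in `{g < 0}` for a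
continuous `g`, they lie in `{g < -2δ}` for some `δ > 0` (compactness of
`⋃ᵢ φᵢ(Sᵏ × D̄)`). [folklore] -/
theorem exists_forall_apply_lt {m : ℕ} (ν : FramedSphereFamily (𝓡 (n + 1)) N ι k m)
    {g : N → ℝ} (hg : Continuous g) (hν : ∀ i v w, ‖w‖ ≤ 1 → g (ν.toFun i (v, w)) < 0) :
    ∃ δ : ℝ, 0 < δ ∧ ∀ i v w, ‖w‖ ≤ 1 → g (ν.toFun i (v, w)) < -(2 * δ) := by
  set K : Set N := ⋃ i, (ν.toFun i) '' (univ ×ˢ Metric.closedBall (0 : 𝔼 m) 1) with hK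
  have hKc : IsCompact K := isCompact_iUnion fun i =>
    ((isCompact_univ.prod (isCompact_closedBall _ _)).image (ν.continuous i))
  have hmemK : ∀ i v w, ‖w‖ ≤ 1 → ν.toFun i (v, w) ∈ K := fun i v w hw =>
    mem_iUnion.2 ⟨i, mem_image_of_mem _ ⟨mem_univ _, mem_closedBall_zero_iff.2 hw⟩⟩
  have hneg : ∀ x ∈ K, g x < 0 := by
    intro x hx
    obtain ⟨i, hx⟩ := mem_iUnion.1 hx
    obtain ⟨⟨v, w⟩, ⟨-, hw⟩, rfl⟩ := hx
    exact hν i v w (mem_closedBall_zero_iff.1 hw)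
  rcases K.eq_empty_or_nonempty with hKe | hKne
  · refine ⟨1, one_pos, fun i v w hw => ?_⟩
    have h := hmemK i v w hw
    rw [hKe] at h
    exact h.elim
  · obtain ⟨x₀, hx₀, hmax⟩ := hKc.exists_isMaxOn hKne hg.continuousOn
    refine ⟨-(g x₀) / 4, by linarith [hneg x₀ hx₀], fun i v w hw => ?_⟩
    have h1 : g (ν.toFun i (v, w)) ≤ g x₀ := hmax (hmemK i v w hw)
    linarith [hneg x₀ hx₀]

variable (ν : FramedSphereFamily (𝓡 (n + 1)) N ι k (l + 1))
  {X : Type u} [TopologicalSpace X] [ChartedSpace (𝔼 (n + 1)) X]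
  {jA : ↥ν.complement → X} {jB : ↥(ballTimesSphere ι k l) → X}

omit [IsManifold (𝓡 (n + 1)) ∞ N] in
/-- Points of `N ∖ cores` which are identified with points of the new piece lie in the
closed (indeed open) unit tubes: if `sphereFamilySurgeryRel ν a b` then `a = φᵢ (v, w)` with
`‖w‖ ≤ 1` (Milnor's *"`φ(u, θv)`, `0 < θ < 1`"*). [cite: MilnorHCobordism1965, Def. 3.11 (PDF p. 17)] -/
theorem exists_eq_apply_of_sphereFamilySurgeryRel {a : ↥ν.complement}
    {b : ↥(ballTimesSphere ι k l)} (h : sphereFamilySurgeryRel ν a b) :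
    ∃ i v w, ‖w‖ ≤ 1 ∧ (a : N) = ν.toFun i (v, w) := by
  obtain ⟨v, θ, hθ, -, ha⟩ := h
  refine ⟨_, v, _, ?_, ha⟩
  rw [norm_smul, Real.norm_eq_abs, abs_of_pos hθ.1, norm_eq_of_mem_sphere
    (b : DiscreteIndex ι × ((𝔼 (k + 1)) × (𝕊 l))).2.2, mul_one]
  exact hθ.2.le

omit [IsManifold (𝓡 (n + 1)) ∞ N] in
/-- **The level function on the surgered manifold** (Matveyev 1996, Proof of Theorem, step 3,
read through Milnor's Def. 3.11; Kirby 1996, §1: *"`S₀ × B²` has been removed from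
`A_{1/2} × (1/2 - ε)` and replaced by `B³ × S¹_{1/2-ε}`"* — the surgery takes place inside the
sub-domain). Let `X = jA(N ∖ cores) ∪ jB(ι × D̊ᵏ⁺¹ × Sˡ)` be obtained from the manifold
without boundary `N` by surgery along the framed family `ν` (`IsOpenGluingWith … jA jB` along
`sphereFamilySurgeryRel ν`), and let `g : N → ℝ` have the regular level `0`, with the closed
unit tubes of `ν` inside `{g < 0}`. Then there are `δ > 0` and a smooth `ĝ : X → ℝ` with
regular level `0` such that `ĝ ∘ jA = levelCutoff δ ∘ g` — so `ĝ (jA a) = g a` wherever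
`g a ≥ -δ`, and `ĝ ∘ jA`, `g` have the same sign and the same zeros — and `ĝ ∘ jB ≡ -δ`:
the function `g`, flattened to the constant `-δ` on `{g ≤ -2δ} ⊇` tubes, descends to the
gluing (`IsOpenGluingWith.exists_contMDiff_apply_eq`); its zero level lies in `jA({g > -δ})`
where it is `g` read through the open embedding `jA` (`IsMCriticalPt.comp`,
`isMCriticalPt_comp_subtype_val_iff`). [cite: Matveyev1996, Proof of Theorem, step 3 (arXiv p. 2)]
[cite: MilnorHCobordism1965, Def. 3.11 (PDF p. 17)] -/
theorem exists_isRegularLevel_glue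
    (hX : IsOpenGluingWith (𝓡 (n + 1)) ((𝓡 0).prod ((𝓡 (k + 1)).prod (𝓡 l))) (𝓡 (n + 1))
      (sphereFamilySurgeryRel ν) jA jB)
    {g : N → ℝ} (h0 : IsRegularLevel (𝓡 (n + 1)) g 0)
    (hν : ∀ i v w, ‖w‖ ≤ 1 → g (ν.toFun i (v, w)) < 0) :
    ∃ (δ : ℝ) (ĝ : X → ℝ), 0 < δ ∧ IsRegularLevel (𝓡 (n + 1)) ĝ 0 ∧
      (∀ a, ĝ (jA a) = levelCutoff δ (g a)) ∧ (∀ b, ĝ (jB b) = -δ) ∧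
      ∀ i v w, ‖w‖ ≤ 1 → g (ν.toFun i (v, w)) < -(2 * δ) := by
  obtain ⟨δ, hδ, hδν⟩ := ν.exists_forall_apply_lt h0.contMDiff.continuous hν
  set FA : ↥ν.complement → ℝ := fun a => levelCutoff δ (g a) with hFA
  have hFAs : ContMDiff (𝓡 (n + 1)) 𝓘(ℝ, ℝ) ∞ FA :=
    (contDiff_levelCutoff δ).contMDiff.comp (h0.contMDiff.comp contMDiff_subtype_val)
  have hFBs : ContMDiff ((𝓡 0).prod ((𝓡 (k + 1)).prod (𝓡 l))) 𝓘(ℝ, ℝ) ∞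
      (fun _ : ↥(ballTimesSphere ι k l) => -δ) := contMDiff_const
  have hcomp : ∀ a b, sphereFamilySurgeryRel ν a b → FA a = -δ := by
    intro a b hab
    obtain ⟨i, v, w, hw, ha⟩ := ν.exists_eq_apply_of_sphereFamilySurgeryRel hab
    simp only [hFA, ha]
    exact levelCutoff_of_le hδ (hδν i v w hw).le
  obtain ⟨G, hG, hGA, hGB⟩ := hX.exists_contMDiff_apply_eq hFAs hFBs hcomp
  obtain ⟨hAemb, hAo, hBemb, hBo, hU, hR⟩ := hX
  refine ⟨δ, G, hδ, isRegularLevel_of_not_isMCriticalPt hG fun p hp hc => ?_, hGA, hGB, hδν⟩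
  rcases eq_univ_iff_forall.1 hU p with ⟨a, rfl⟩ | ⟨b, rfl⟩
  · rw [hGA] at hp
    have hga : g a = 0 := (levelCutoff_eq_zero_iff hδ _).1 hp
    have h1 : IsMCriticalPt (𝓡 (n + 1)) (G ∘ jA) a :=
      hc.comp ((hG (jA a)).mdifferentiableAt (by simp))
        ((hAemb.contMDiff a).mdifferentiableAt (by simp))
    have h2 : G ∘ jA = (fun y => levelCutoff δ (g y)) ∘ Subtype.val := funext fun a => hGA a
    have hd : MDifferentiableAt (𝓡 (n + 1)) 𝓘(ℝ, ℝ) (fun y => levelCutoff δ (g y)) a.1 :=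
      ((((contDiff_levelCutoff δ).contMDiff.comp h0.contMDiff) a.1).mdifferentiableAt (by simp))
    rw [h2, isMCriticalPt_comp_subtype_val_iff hd] at h1
    have h3 : IsMCriticalPt (𝓡 (n + 1)) g a.1 := by
      unfold IsMCriticalPt at h1 ⊢
      rwa [(levelCutoff_comp_eventuallyEq h0.contMDiff.continuous hδ
        (show -δ < g a.1 by rw [hga]; linarith)).mfderiv_eq] at h1
    exact h0.not_isMCriticalPt hga h3
  · rw [hGB] at hp
    linarith

variable [IsManifold (𝓡 (n + 1)) ∞ X]

/-- **Surgery inside a regular domain: the exterior is untouched and the surgered manifold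
splits along the level** (Matveyev 1996, Proof of Theorem, step 3: *"Put
`M := cl(N ∖ V₃) ≅ cl(M₁ ∖ W₁) ≅ cl(M₂ ∖ W₂)`. So we have the decompositions
`M₁ = M #_Σ W₁`, `M₂ = M #_Σ W₂`"*; Kirby 1996, §3: *"`M - int A` is a product
h-cobordism"*, read on one end). Let `X = jA(N ∖ cores) ∪ jB(…)` be obtained from `N` by surgery along `ν`, `g : N → ℝ`
with regular level `0` and the core spheres in `{g < 0}`, and `ĝ : X → ℝ` with regular level
`0` such that `ĝ ∘ jA` and `g` have the same sign on `N ∖ cores` and `ĝ < 0` on the new piece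
(e.g. the function of `exists_isRegularLevel_glue`). Then:
* the open embedding `jA` induces a diffeomorphism `Φ : {g ≥ 0} ≅ {ĝ ≥ 0}` of the regular
  superlevel sets (manifolds with boundary; `RegularSublevel.equivOfIsOpenRange` twice, through
  `N ∖ cores`), `incl (Φ p) = jA (incl p)`;
* `X` is the gluing along the boundary of `W := {ĝ ≤ 0}` (a compact manifold with boundary
  when `X` is compact, `RegularLevelSplitting.lean`) and the **exterior `M := {g ≥ 0} ⊆ N`,
  which depends only on `(N, g)`** and not on the surgery: `X = W ∪_ψ M` for a
  diffeomorphism `ψ : ∂W ≅ ∂M` characterised by `Φ (ψ z) = z` read through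
  `∂W = ĝ⁻¹(0) = ∂{ĝ ≥ 0}` (`RegularSublevel.isBoundaryGluing_split` transported along `Φ`
  by `IsBoundaryGluing.transfer`; `ψ = (∂Φ ≫ split⁻¹)⁻¹`), i.e. on points: the seam point
  `z ∈ ∂W ⊂ X` is `jA` of the point `ψ z ∈ ∂M = g⁻¹(0) ⊂ N ∖ cores` (last clause).
So all the manifolds obtained from `N` by surgeries inside `{g < 0}` contain the common
exterior `{g ≥ 0}` glued along `g⁻¹(0)` — Matveyev's `M₁ = M #_Σ W₁`, `M₂ = M #_Σ W₂`.
[cite: Matveyev1996, Proof of Theorem, step 3 (arXiv p. 2)]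
[cite: KirbyCorks1996, §3] -/
theorem exists_diffeomorph_isBoundaryGluing_regularSuperlevel
    (hX : IsOpenGluingWith (𝓡 (n + 1)) ((𝓡 0).prod ((𝓡 (k + 1)).prod (𝓡 l))) (𝓡 (n + 1))
      (sphereFamilySurgeryRel ν) jA jB)
    {g : N → ℝ} (h0 : IsRegularLevel (𝓡 (n + 1)) g 0) (hcores : ∀ i v, g (ν.sphere i v) < 0)
    {ĝ : X → ℝ} (ĥ : IsRegularLevel (𝓡 (n + 1)) ĝ 0)
    (hA : ∀ a, 0 ≤ ĝ (jA a) ↔ 0 ≤ g a) (hB : ∀ b, ĝ (jB b) < 0) :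
    ∃ Φ : RegularSuperlevel h0 ≃ₘ⟮𝓡∂ (n + 1), 𝓡∂ (n + 1)⟯ RegularSuperlevel ĥ,
      (∀ p, ∃ hp : RegularSublevel.incl h0.const_sub p ∈ ν.complement,
        RegularSublevel.incl ĥ.const_sub (Φ p) = jA ⟨RegularSublevel.incl h0.const_sub p, hp⟩) ∧
      ∃ ψ : (RegularSublevel.boundaryData ĥ).carrier ≃ₘ⟮𝓡 n, 𝓡 n⟯
          (RegularSublevel.boundaryData h0.const_sub).carrier,
        IsBoundaryGluing (RegularSublevel.boundaryData ĥ) (RegularSublevel.boundaryData h0.const_sub)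
          ψ (𝓡 (n + 1)) X ∧
        (∀ z, Φ ((RegularSublevel.boundaryData h0.const_sub).incl (ψ z)) =
          (RegularSublevel.splitDiffeomorph ĥ z).1) ∧
        ∀ z, ∃ a : ↥ν.complement,
          (a : N) = RegularSublevel.incl h0.const_sub
            ((RegularSublevel.boundaryData h0.const_sub).incl (ψ z)) ∧
          jA a = RegularSublevel.incl ĥ ((RegularSublevel.boundaryData ĥ).incl z) := by
  obtain ⟨hAemb, hAo, hBemb, hBo, hU, hR⟩ := hX
  -- the intermediate manifold `N ∖ cores` with the function `ĝ ∘ jA`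
  have hF : IsRegularLevel (𝓡 (n + 1)) (ĝ ∘ jA) 0 := ĥ.comp_isSmoothEmbedding hAemb hAo
  have hval : Manifold.IsSmoothEmbedding (𝓡 (n + 1)) (𝓡 (n + 1)) ∞
      (Subtype.val : ↥ν.complement → N) := Manifold.IsSmoothEmbedding.of_opens _
  have hvalo : IsOpen (range (Subtype.val : ↥ν.complement → N)) := by
    rw [Subtype.range_coe]
    exact ν.complement.isOpen
  -- `{g ≥ 0} ⊆ N ∖ cores`
  have hsub₁ : (fun y => 0 - g y) ⁻¹' Iic 0 ⊆ range (Subtype.val : ↥ν.complement → N) := by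
    intro y hy
    rw [Subtype.range_coe]
    rw [mem_preimage, mem_Iic, sub_nonpos] at hy
    simp only [SetLike.mem_coe, mem_complement_iff, mem_cores_iff, not_exists]
    rintro i v rfl
    exact absurd (hcores i v) (not_lt.2 hy)
  -- `{ĝ ≥ 0} ⊆ jA(N ∖ cores)`
  have hsub₂ : (fun y => 0 - ĝ y) ⁻¹' Iic 0 ⊆ range jA := by
    intro y hy
    rw [mem_preimage, mem_Iic, sub_nonpos] at hy
    rcases eq_univ_iff_forall.1 hU y with ⟨a, rfl⟩ | ⟨b, rfl⟩
    · exact mem_range_self a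
    · exact absurd (hB b) (not_lt.2 hy)
  set Φ₁ := RegularSublevel.equivOfIsOpenRange hF.const_sub h0.const_sub Subtype.val hval hvalo
    (fun a => by simpa only [sub_nonpos, comp_apply] using (hA a).symm) hsub₁ with hΦ₁
  set Φ₂ := RegularSublevel.equivOfIsOpenRange hF.const_sub ĥ.const_sub jA hAemb hAo
    (fun a => Iff.rfl) hsub₂ with hΦ₂
  set Φ := Φ₁.symm.trans Φ₂ with hΦ
  -- `Φ` on points: `incl (Φ p) = jA (incl p)`
  have hpt : ∀ p, ∃ hp : RegularSublevel.incl h0.const_sub p ∈ ν.complement,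
      RegularSublevel.incl ĥ.const_sub (Φ p) = jA ⟨RegularSublevel.incl h0.const_sub p, hp⟩ := by
    intro p
    refine ⟨?_, ?_⟩
    · rw [← RegularSublevel.apply_incl_equivOfIsOpenRange_symm hF.const_sub h0.const_sub
        Subtype.val hval hvalo (fun a => by simpa only [sub_nonpos, comp_apply] using (hA a).symm)
        hsub₁ p]
      exact Subtype.coe_prop _
    · show RegularSublevel.incl ĥ.const_sub (Φ₂ (Φ₁.symm p)) = _
      rw [hΦ₂, RegularSublevel.incl_equivOfIsOpenRange]
      congr 1
      apply Subtype.ext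
      exact RegularSublevel.apply_incl_equivOfIsOpenRange_symm hF.const_sub h0.const_sub
        Subtype.val hval hvalo _ hsub₁ p
  -- the splitting of `X` along `ĝ = 0`, transported along `Φ`
  have h1 := (RegularSublevel.isBoundaryGluing_split ĥ).symm'
  have h2 := h1.transfer (b₁ := RegularSublevel.boundaryData h0.const_sub) Φ
  set T := (RegularSublevel.boundaryData h0.const_sub).restrictDiffeomorph
    (RegularSublevel.boundaryData ĥ.const_sub) Φ with hT
  have h3 : IsBoundaryGluing (RegularSublevel.boundaryData h0.const_sub)
      (RegularSublevel.boundaryData ĥ) (T.trans (RegularSublevel.splitDiffeomorph ĥ).symm)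
      (𝓡 (n + 1)) X := h2
  set ψ := (T.trans (RegularSublevel.splitDiffeomorph ĥ).symm).symm with hψdef
  have hψ : ∀ z, Φ ((RegularSublevel.boundaryData h0.const_sub).incl (ψ z)) =
      (RegularSublevel.splitDiffeomorph ĥ z).1 := by
    intro z
    show Φ ((RegularSublevel.boundaryData h0.const_sub).incl
      (T.symm (RegularSublevel.splitDiffeomorph ĥ z))) = _
    rw [hT, BoundaryData.restrictDiffeomorph_symm, BoundaryData.incl_restrictDiffeomorph,
      Diffeomorph.apply_symm_apply]
    rfl
  refine ⟨Φ, hpt, ψ, h3.symm', hψ, fun z => ?_⟩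
  obtain ⟨hp, heq⟩ := hpt ((RegularSublevel.boundaryData h0.const_sub).incl (ψ z))
  refine ⟨⟨_, hp⟩, rfl, ?_⟩
  rw [← heq, hψ z, RegularSublevel.incl_splitDiffeomorph]
  rfl

/-- **Matveyev's decomposition sentence for two surgeries inside one regular domain**
(Proof of Theorem, step 3, arXiv p. 2: *"Surgery of `V₃` along collections of embedded
spheres `{Sᵢ}` and `{Pᵢ}` gives two contractible sub-manifolds `W₁` and `W₂` of `M₁` and
`M₂`, respectively. Put `M := cl(N ∖ V₃) ≅ cl(M₁ ∖ W₁) ≅ cl(M₂ ∖ W₂)`. So we have the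
decompositions: `M₁ = M #_Σ W₁`, `M₂ = M #_Σ W₂`"* — everything except the word
"contractible", the four-dimensional content of steps 1–2).  If `X₁`, `X₂` are obtained from
the manifold without boundary `N` by surgery along framed families `P`, `S` whose closed unit
tubes lie in the regular domain `{g < 0}` (`0` a regular level of `g`), then **with the fixed
exterior `M := {g ≥ 0} ⊆ N`** (`RegularSuperlevel h0`, boundary datum
`RegularSublevel.boundaryData h0.const_sub`, i.e. `Σ = g⁻¹(0)`) one has decompositions
`X₁ = W₁ ∪_{φ₁} M`, `X₂ = W₂ ∪_{φ₂} M` along the boundary, where `Wᵢ = {ĝᵢ ≤ 0} ⊆ Xᵢ`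
(`RegularSublevel ĥᵢ`) for level functions `ĝᵢ` on `Xᵢ` with regular level `0` which are
`levelCutoff δᵢ ∘ g` on `N ∖ cores` (read through the gluing embeddings `jAᵢ`, which are
returned) and the constant `-δᵢ` on the new pieces, and the seam `φᵢ z` of `z ∈ ∂Wᵢ` is the
point of `g⁻¹(0)` mapped to `z` by `jAᵢ`.  All the instances of `RegularLevelSplitting.lean`
apply to `Wᵢ`, `M` (Hausdorff / second countable / compact when `Xᵢ`, resp. `N`, are); this is
the conclusion of `Literature.Topology.FourManifolds.Matveyev1996_partOne_and_fact_of_dualSpheres`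
(H4) with the pieces pinned, minus contractibility and Fact 1.
[cite: Matveyev1996, Proof of Theorem, step 3 (arXiv p. 2)] [cite: KirbyCorks1996, §3] -/
theorem exists_common_exterior_of_isSurgery {ι' : Type w} [Finite ι'] {k' l' : ℕ}
    (P : FramedSphereFamily (𝓡 (n + 1)) N ι k (l + 1))
    (S : FramedSphereFamily (𝓡 (n + 1)) N ι' k' (l' + 1))
    {X₁ : Type u} [TopologicalSpace X₁] [ChartedSpace (𝔼 (n + 1)) X₁]
    [IsManifold (𝓡 (n + 1)) ∞ X₁]
    {X₂ : Type u} [TopologicalSpace X₂] [ChartedSpace (𝔼 (n + 1)) X₂]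
    [IsManifold (𝓡 (n + 1)) ∞ X₂]
    (hX₁ : P.IsSurgery (𝓡 (n + 1)) X₁) (hX₂ : S.IsSurgery (𝓡 (n + 1)) X₂)
    {g : N → ℝ} (h0 : IsRegularLevel (𝓡 (n + 1)) g 0)
    (hP : ∀ i v w, ‖w‖ ≤ 1 → g (P.toFun i (v, w)) < 0)
    (hS : ∀ i v w, ‖w‖ ≤ 1 → g (S.toFun i (v, w)) < 0) :
    ∃ (jA₁ : ↥P.complement → X₁) (jB₁ : ↥(ballTimesSphere ι k l) → X₁)
      (jA₂ : ↥S.complement → X₂) (jB₂ : ↥(ballTimesSphere ι' k' l') → X₂)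
      (δ₁ δ₂ : ℝ) (ĝ₁ : X₁ → ℝ) (ĝ₂ : X₂ → ℝ)
      (ĥ₁ : IsRegularLevel (𝓡 (n + 1)) ĝ₁ 0) (ĥ₂ : IsRegularLevel (𝓡 (n + 1)) ĝ₂ 0)
      (φ₁ : (RegularSublevel.boundaryData ĥ₁).carrier ≃ₘ⟮𝓡 n, 𝓡 n⟯
        (RegularSublevel.boundaryData h0.const_sub).carrier)
      (φ₂ : (RegularSublevel.boundaryData ĥ₂).carrier ≃ₘ⟮𝓡 n, 𝓡 n⟯
        (RegularSublevel.boundaryData h0.const_sub).carrier),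
      IsOpenGluingWith (𝓡 (n + 1)) ((𝓡 0).prod ((𝓡 (k + 1)).prod (𝓡 l))) (𝓡 (n + 1))
        (sphereFamilySurgeryRel P) jA₁ jB₁ ∧
      IsOpenGluingWith (𝓡 (n + 1)) ((𝓡 0).prod ((𝓡 (k' + 1)).prod (𝓡 l'))) (𝓡 (n + 1))
        (sphereFamilySurgeryRel S) jA₂ jB₂ ∧
      0 < δ₁ ∧ 0 < δ₂ ∧
      (∀ a, ĝ₁ (jA₁ a) = levelCutoff δ₁ (g a)) ∧ (∀ b, ĝ₁ (jB₁ b) = -δ₁) ∧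
      (∀ a, ĝ₂ (jA₂ a) = levelCutoff δ₂ (g a)) ∧ (∀ b, ĝ₂ (jB₂ b) = -δ₂) ∧
      IsBoundaryGluing (RegularSublevel.boundaryData ĥ₁)
        (RegularSublevel.boundaryData h0.const_sub) φ₁ (𝓡 (n + 1)) X₁ ∧
      IsBoundaryGluing (RegularSublevel.boundaryData ĥ₂)
        (RegularSublevel.boundaryData h0.const_sub) φ₂ (𝓡 (n + 1)) X₂ ∧
      (∀ z, ∃ a : ↥P.complement,
        (a : N) = RegularSublevel.incl h0.const_sub
          ((RegularSublevel.boundaryData h0.const_sub).incl (φ₁ z)) ∧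
        jA₁ a = RegularSublevel.incl ĥ₁ ((RegularSublevel.boundaryData ĥ₁).incl z)) ∧
      (∀ z, ∃ a : ↥S.complement,
        (a : N) = RegularSublevel.incl h0.const_sub
          ((RegularSublevel.boundaryData h0.const_sub).incl (φ₂ z)) ∧
        jA₂ a = RegularSublevel.incl ĥ₂ ((RegularSublevel.boundaryData ĥ₂).incl z)) := by
  obtain ⟨jA₁, jB₁, h₁⟩ := hX₁
  obtain ⟨jA₂, jB₂, h₂⟩ := hX₂
  obtain ⟨δ₁, ĝ₁, hδ₁, ĥ₁, hA₁, hB₁, -⟩ := P.exists_isRegularLevel_glue h₁ h0 hP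
  obtain ⟨δ₂, ĝ₂, hδ₂, ĥ₂, hA₂, hB₂, -⟩ := S.exists_isRegularLevel_glue h₂ h0 hS
  obtain ⟨Φ₁, -, ψ₁, hW₁, -, hs₁⟩ := P.exists_diffeomorph_isBoundaryGluing_regularSuperlevel h₁
    h0 (fun i v => by simpa using hP i v 0 (by simp)) ĥ₁
    (fun a => by rw [hA₁]; exact levelCutoff_nonneg_iff hδ₁ _) (fun b => by rw [hB₁]; linarith)
  obtain ⟨Φ₂, -, ψ₂, hW₂, -, hs₂⟩ := S.exists_diffeomorph_isBoundaryGluing_regularSuperlevel h₂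
    h0 (fun i v => by simpa using hS i v 0 (by simp)) ĥ₂
    (fun a => by rw [hA₂]; exact levelCutoff_nonneg_iff hδ₂ _) (fun b => by rw [hB₂]; linarith)
  exact ⟨jA₁, jB₁, jA₂, jB₂, δ₁, δ₂, ĝ₁, ĝ₂, ĥ₁, ĥ₂, ψ₁, ψ₂, h₁, h₂, hδ₁, hδ₂, hA₁, hB₁, hA₂,
    hB₂, hW₁, hW₂, hs₁, hs₂⟩

end FramedSphereFamily

end Surgery

end Literature.Topology.FourManifolds

end
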